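import Summits.ResolutionOfSingularities.ResolutionOfSingularities.Theorems.FrobeniusLadderFInjectiveMacaulayficationTwoLevelRoadFrame
import Summits.ResolutionOfSingularities.ResolutionOfSingularities.Theorems.FrobeniusLadderFInjectiveMacaulayficationT11Char3Poly
import Summits.ResolutionOfSingularities.ResolutionOfSingularities.Theorems.FrobeniusLadderFInjectiveMacaulayficationT11Char7FanData
import Summits.ResolutionOfSingularities.ResolutionOfSingularities.Theorems.FrobeniusLadderFInjectiveMacaulayficationT11Char7Poly
import Summits.ResolutionOfSingularities.ResolutionOfSingularities.Theorems.FrobeniusLadderFInjectiveMacaulayficationT11HypersurfacePrime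
import Summits.ResolutionOfSingularities.ResolutionOfSingularities.Theorems.FrobeniusLadderFInjectiveMacaulayficationMonomialChartPresentationPrime
import Summits.ResolutionOfSingularities.ResolutionOfSingularities.Theorems.FrobeniusLadderFInjectiveMacaulayficationCIConeFiModelCore
import Summits.ResolutionOfSingularities.ResolutionOfSingularities.Theorems.FrobeniusLadderFInjectiveMacaulayficationCICertificates
import Summits.ResolutionOfSingularities.ResolutionOfSingularities.Theorems.FrobeniusLadderFInjectiveMacaulayficationReesCoverOfPowers
import Summits.ResolutionOfSingularities.ResolutionOfSingularities.Theorems.FrobeniusLadderFInjectiveMacaulayficationQuotientOriginMaximal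
import Summits.ResolutionOfSingularities.ResolutionOfSingularities.Theorems.FrobeniusLadderFInjectiveMacaulayficationT11SpecimenDoorChar3
import Summits.ResolutionOfSingularities.ResolutionOfSingularities.Theorems.FrobeniusLadderFInjectiveMacaulayficationT11PlusOriginTransportStalk
import HarnessLib

/-!
# E7 — THE T₁₁/3 FRAME: the crux conclusion for `T₁₁⁺` over every field of characteristic 3, MODULO EXACTLY THE THREE DATA DELIVERIES
# (crux `FInjectiveMacaulayfication` stmt-ResolutionOfSingularities-15315, chain w45a; E7 wiring v2 / R13.19 / R13.20 / R13.13)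

[OURS · L1 W4.5a · res-L1-w45a-lead-1 gen 5] Support file (`--supports stmt-ResolutionOfSingularities-15315 --as helper`); NOT a statement of
any manuscript; AI-written, weaker than expert review.

`TwoLevelRoadFrame.pointFixable_of_chartModels₂` instantiated at `R = k[x,y,z,w]/(T₁₁)`, `I = I_A·R` (the 87-chart fan Σ_own of
res-L1-w45a-tri-1's certificate, tables `T11Char7Fan.*` of res-L1-w45a-stub-3 — characteristic-free), Rees charts `D₊(x̄^{m_c} t)`, models
`B c = k[y]/(g_c)` (`g_c = KLocCellKit.evalL k (T11Char7Poly.G c)`) with (C1) `MonomialChartPresentationPrime` and the pinned sections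
isomorphisms of res-type-034's `AffineBlowupChartTransport`; ALL plumbing discharged here (origin maximal, `√I = 𝔪₀`, Rees cover from
`T11Char7Fan.hcov` by `ReesCoverOfPowers`, domains / Noetherian / Jacobson / characteristic, fibre ideals, the model fibre ideals
`𝔟″ c = (θ_c(x_j))_j`). What remains are EXACTLY the three data deliveries, as hypotheses in their agreed binder shapes:

* `hstd` / `hoff` — LEVEL-1 MODEL CLAUSES (res-L1-w45a-stub-5's producers `T11Char3Poly.hon3_of_cells` on the 80 charts with
  `SSoff c = []`, `T11Char3Poly.hon3_of_cells_off` on the 7 avoid charts, fed by res-L1-w45a-stub-4's p = 3 cell texts);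
* `hR3` — THE CURVE DATA (res-type-034's R3 data half, `…T11Char3Curve.lean`): for ANY pinned `e c` and ANY (C1)-spec'd `θ c`, a point
  `ξ` over the origin with (R3a) `e_c(𝓘(closure{ξ})(U c)) ≤ θ_c(P_c)` on the avoid charts, (R3b) equality on the hon charts 64, 66, and
  (R3c) `closure {ξ} ⊆ U 64 ∪ U 66`;
* `hblock64` / `hblock66` — LEVEL-2 certificate blocks on the models of the two hon charts for the curve's model ideal `P_σ`
  (`LineBlowupFan4` + `CICertificates.ciCertificates` on the translated model + `LevelTwoBlockTranslate.block_of_translated`).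

OUTPUT: `t11_originPointFixable_char3_of_data` — `PFix₃` at the origin of the hypersurface model (the `h0` shape, `Ideal.span {T₁₁}` base),
and `fInjectiveMacaulayfication_T11plus_char3_of_data` — THE CRUX STATEMENT FOR `X = T₁₁⁺ ⊂ 𝔸⁵_k`, `char k = 3`, modulo the same data
(range bridge + res-L1-w45a-stub-2's stalk transport + res-L1-w45a-stub-3's `T11SpecimenDoorChar3`). No definitions, no named facts. [folklore glue]
-/

-- single-problem summit: the doubled namespace component is forced
set_option linter.dupNamespace false

noncomputable section

namespace Summit.ResolutionOfSingularities.ResolutionOfSingularities.Theorems.FInjectiveMacaulayfication.T11Char3Frame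

open AlgebraicGeometry CategoryTheory TopologicalSpace Literature.AlgebraicGeometry.Resolution MvPolynomial
open Summit.ResolutionOfSingularities.ResolutionOfSingularities.Theorems.FInjectiveMacaulayfication

/-! ## §1 Generic preliminaries on a prime hypersurface `k[X]/(f)` through the origin with a monomial centre -/

section Prelim

variable {k : Type} [Field k] {n : ℕ} (f : MvPolynomial (Fin n) k)

/-- The origin `(x̄₁,…,x̄ₙ)` of `k[X]/(f)` is a maximal ideal when `f(0) = 0`. [folklore] -/
theorem origin_isMaximal (hf0 : constantCoeff f = 0) :
    (Ideal.span (Set.range fun i : Fin n => Ideal.Quotient.mk (Ideal.span {f}) (X i))).IsMaximal := by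
  have hmap : Ideal.span (Set.range fun i : Fin n => Ideal.Quotient.mk (Ideal.span {f}) (X i)) =
      (idealOfVars (Fin n) k).map (Ideal.Quotient.mk (Ideal.span {f})) := by
    rw [idealOfVars, Ideal.map_span, ← Set.range_comp]
    rfl
  rw [hmap]
  haveI := QuotientOriginMaximal.idealOfVars_isMaximal k (n := n)
  refine Ideal.IsMaximal.map_of_surjective_of_ker_le Ideal.Quotient.mk_surjective ?_
  rw [Ideal.mk_ker, Ideal.span_le, Set.singleton_subset_iff]
  exact (QuotientOriginMaximal.mem_idealOfVars_iff k f).mpr hf0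

/-- `√(I_A·R) = 𝔪₀` for a monomial centre whose exponents all involve a variable and which contains a pure power of every variable.
[folklore] -/
theorem radical_monomialCentre_eq_origin (hf0 : constantCoeff f = 0) (A : Finset (Fin n →₀ ℕ))
    (hpos : ∀ x ∈ A, ∃ j ∈ (Finset.univ : Finset (Fin n)), 0 < x j)
    (hpow : ∀ j ∈ (Finset.univ : Finset (Fin n)), ∃ N : ℕ, Finsupp.single j N ∈ A) :
    (Ideal.span ((fun e : Fin n →₀ ℕ => Ideal.Quotient.mk (Ideal.span {f}) (monomial e (1 : k))) '' (A : Set (Fin n →₀ ℕ)))).radical =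
      Ideal.span (Set.range fun i : Fin n => Ideal.Quotient.mk (Ideal.span {f}) (X i)) := by
  haveI := origin_isMaximal f hf0
  apply le_antisymm
  · -- `I ≤ 𝔪₀`, and `𝔪₀` is prime
    exact ((Ideal.IsMaximal.isPrime ‹_›).radical_le_iff).mpr
      ((CICertificates.centre_le_iff (Ideal.span {f}) Finset.univ A hpos hpow _).mpr (fun j _ => Ideal.subset_span ⟨j, rfl⟩))
  · rw [Ideal.span_le, Set.range_subset_iff]
    intro j
    obtain ⟨N, hN⟩ := hpow j (Finset.mem_univ j)
    refine ⟨N, Ideal.subset_span ⟨_, hN, ?_⟩⟩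
    rw [← map_pow, X_pow_eq_monomial]

/-- The centre is nonzero (it contains a pure power of a variable, and no variable vanishes on the prime hypersurface). [folklore] -/
theorem monomialCentre_ne_bot [(Ideal.span {f}).IsPrime] (hn : 0 < n)
    (hXne : ∀ v : Fin n, Ideal.Quotient.mk (Ideal.span {f}) (X v) ≠ 0) (A : Finset (Fin n →₀ ℕ))
    (hpow : ∀ j ∈ (Finset.univ : Finset (Fin n)), ∃ N : ℕ, Finsupp.single j N ∈ A) :
    Ideal.span ((fun e : Fin n →₀ ℕ => Ideal.Quotient.mk (Ideal.span {f}) (monomial e (1 : k))) '' (A : Set (Fin n →₀ ℕ))) ≠ ⊥ := by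
  obtain ⟨N, hN⟩ := hpow ⟨0, hn⟩ (Finset.mem_univ _)
  intro h
  have hmem : Ideal.Quotient.mk (Ideal.span {f}) (monomial (Finsupp.single (⟨0, hn⟩ : Fin n) N) (1 : k)) ∈
      Ideal.span ((fun e : Fin n →₀ ℕ => Ideal.Quotient.mk (Ideal.span {f}) (monomial e (1 : k))) '' (A : Set (Fin n →₀ ℕ))) :=
    Ideal.subset_span ⟨_, hN, rfl⟩
  rw [h, Ideal.mem_bot] at hmem
  exact CIConeFiModelCore.mk_monomial_ne_zero (Ideal.span {f}) hXne _ hmem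

/-- **The Rees cover of `Bl_I` by the vertex charts `D₊(x̄^{m c} t)`**, read off the fan's cover records (as in `CICertificates.ciCertificates`).
[folklore] -/
theorem reesCover_of_fanCover (A : Finset (Fin n →₀ ℕ)) {t : ℕ} (m : Fin t → (Fin n →₀ ℕ)) (hmA : ∀ c, m c ∈ A)
    (hcov : ∀ a ∈ A, ∃ (c : Fin t) (K : ℕ), 1 ≤ K ∧ ∃ y ∈ (Ideal.span ((fun b : Fin n →₀ ℕ =>
        (MvPolynomial.monomial b (1 : k) : MvPolynomial (Fin n) k)) '' (A : Set (Fin n →₀ ℕ)))) ^ (K - 1),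
      (MvPolynomial.monomial a (1 : k) : MvPolynomial (Fin n) k) ^ K = MvPolynomial.monomial (m c) 1 * y) :
    (HomogeneousIdeal.irrelevant (reesGrading (Ideal.span ((fun e : Fin n →₀ ℕ => Ideal.Quotient.mk (Ideal.span {f})
        (monomial e (1 : k))) '' (A : Set (Fin n →₀ ℕ)))))).toIdeal ≤
      (Ideal.span (Set.range fun c : Fin t => reesT (I := (Ideal.span ((fun e : Fin n →₀ ℕ => Ideal.Quotient.mk (Ideal.span {f})
        (monomial e (1 : k))) '' (A : Set (Fin n →₀ ℕ)))))
          (Ideal.Quotient.mk (Ideal.span {f}) (monomial (m c) (1 : k))) (Ideal.subset_span ⟨m c, hmA c, rfl⟩))).radical := by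
  have hImap : (Ideal.span ((fun e : Fin n →₀ ℕ => Ideal.Quotient.mk (Ideal.span {f}) (monomial e (1 : k))) '' (A : Set (Fin n →₀ ℕ)))) =
      (Ideal.span ((fun b : Fin n →₀ ℕ => (MvPolynomial.monomial b (1 : k) : MvPolynomial (Fin n) k)) '' (A : Set (Fin n →₀ ℕ)))).map
        (Ideal.Quotient.mk (Ideal.span {f})) := by
    rw [Ideal.map_span, Set.image_image]
  refine ReesCoverOfPowers.stub_reesCoverOfPowers _ _ (Ideal.Quotient.mk (Ideal.span {f}) '' ((fun b : Fin n →₀ ℕ =>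
    (MvPolynomial.monomial b (1 : k) : MvPolynomial (Fin n) k)) '' (A : Set (Fin n →₀ ℕ)))) (by rw [hImap, Ideal.map_span]) t _ _ ?_
  rintro _ ⟨_, ⟨a', ha', rfl⟩, rfl⟩
  obtain ⟨c, K, hK, y, hy, hEq⟩ := hcov a' ha'
  refine ⟨c, K, hK, Ideal.Quotient.mk (Ideal.span {f}) y, ?_, ?_⟩
  · rw [hImap, ← Ideal.map_pow]
    exact Ideal.mem_map_of_mem _ hy
  · rw [← map_pow, hEq, map_mul]

end Prelim


/-! ## §2 The T₁₁/3 frame (`f` is kept a variable pinned by `hf`, so that the statement elaborates cheaply) -/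

set_option maxHeartbeats 1600000 in
/-- **T₁₁/3 — `PFix₃` AT THE ORIGIN OF `X = V(T₁₁) ⊂ 𝔸⁴_k` (char 3) MODULO THE THREE DATA DELIVERIES** (`hstd`/`hoff`: level-1 model
clauses; `hR3`: the curve data; `hblock64`/`hblock66`: level-2 blocks). See the module docstring. [folklore glue] -/
theorem t11_originPointFixable_char3_of_data (k : Type) [Field k] [CharP k 3] (f : MvPolynomial (Fin 4) k)
    (hf : f = (X 2 ^ 2 + (X 1 ^ 2 + X 0 ^ 3) ^ 3 + X 0 ^ 11 + X 3 ^ 7 : MvPolynomial (Fin 4) k)) (hf0 : constantCoeff f = 0)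
    -- LEVEL-1 MODEL CLAUSES (stub-5's producers on stub-4's cell texts)
    (hstd : ∀ c : Fin 87, T11Char3Poly.SSoff c = [] →
      ∀ (Q' : Ideal (MvPolynomial (Fin 4) k ⧸ Ideal.span {(KLocCellKit.evalL k (T11Char7Poly.G c))})) [Q'.IsMaximal],
        (∀ j ∈ (Finset.univ : Finset (Fin 4)), Ideal.Quotient.mk (Ideal.span {(KLocCellKit.evalL k (T11Char7Poly.G c))})
          (aeval (fun j : Fin 4 => ∏ i : Fin 4, (X i : MvPolynomial (Fin 4) k) ^ T11Char7Fan.V c i j) (X j : MvPolynomial (Fin 4) k)) ∈ Q') →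
        ∀ dd : ℕ, ringKrullDim (Localization.AtPrime Q') = dd → ∀ s : Fin dd → Localization.AtPrime Q',
          (Ideal.span (Set.range s)).radical.IsMaximal →
            RingTheory.Sequence.IsWeaklyRegular (Localization.AtPrime Q') (List.ofFn s) ∧
            ∀ y : Localization.AtPrime Q', (∃ e : ℕ, y ^ 3 ^ e ∈ Ideal.span
              ((fun z : Localization.AtPrime Q' => z ^ 3 ^ e) ''
                (Ideal.span (Set.range s) : Set (Localization.AtPrime Q')))) → y ∈ Ideal.span (Set.range s))
    (hoff : ∀ c : Fin 87, T11Char3Poly.SSoff c ≠ [] →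
      ∀ (Q' : Ideal (MvPolynomial (Fin 4) k ⧸ Ideal.span {(KLocCellKit.evalL k (T11Char7Poly.G c))})) [Q'.IsMaximal],
        (∀ j ∈ (Finset.univ : Finset (Fin 4)), Ideal.Quotient.mk (Ideal.span {(KLocCellKit.evalL k (T11Char7Poly.G c))})
          (aeval (fun j : Fin 4 => ∏ i : Fin 4, (X i : MvPolynomial (Fin 4) k) ^ T11Char7Fan.V c i j) (X j : MvPolynomial (Fin 4) k)) ∈ Q') →
        ¬ ((Ideal.span {x | x ∈ (T11Char3Poly.HS c).map (KLocCellKit.evalL k)}).map (Ideal.Quotient.mk (Ideal.span {(KLocCellKit.evalL k (T11Char7Poly.G c))}))) ≤ Q' →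
        ∀ dd : ℕ, ringKrullDim (Localization.AtPrime Q') = dd → ∀ s : Fin dd → Localization.AtPrime Q',
          (Ideal.span (Set.range s)).radical.IsMaximal →
            RingTheory.Sequence.IsWeaklyRegular (Localization.AtPrime Q') (List.ofFn s) ∧
            ∀ y : Localization.AtPrime Q', (∃ e : ℕ, y ^ 3 ^ e ∈ Ideal.span
              ((fun z : Localization.AtPrime Q' => z ^ 3 ^ e) ''
                (Ideal.span (Set.range s) : Set (Localization.AtPrime Q')))) → y ∈ Ideal.span (Set.range s))
    -- THE CURVE DATA (res-type-034's R3 data half), for any pinned sections isomorphisms and any (C1)-spec'd chart presentations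
    (hR3 : ∀ (e : ∀ c : Fin 87, Γ(affineBlowup (Ideal.span ((fun e : Fin 4 →₀ ℕ => Ideal.Quotient.mk (Ideal.span {f}) (monomial e (1 : k))) '' (T11Char7Fan.A : Set (Fin 4 →₀ ℕ)))), (Proj.basicOpen (reesGrading (Ideal.span ((fun e : Fin 4 →₀ ℕ => Ideal.Quotient.mk (Ideal.span {f}) (monomial e (1 : k))) '' (T11Char7Fan.A : Set (Fin 4 →₀ ℕ))))) (reesT (I := (Ideal.span ((fun e : Fin 4 →₀ ℕ => Ideal.Quotient.mk (Ideal.span {f}) (monomial e (1 : k))) '' (T11Char7Fan.A : Set (Fin 4 →₀ ℕ))))) (Ideal.Quotient.mk (Ideal.span {f}) (monomial (T11Char7Fan.m c) (1 : k))) (Ideal.subset_span ⟨T11Char7Fan.m c, T11Char7Fan.hmA c, rfl⟩ : (Ideal.Quotient.mk (Ideal.span {f}) (monomial (T11Char7Fan.m c) (1 : k))) ∈ (Ideal.span ((fun e : Fin 4 →₀ ℕ => Ideal.Quotient.mk (Ideal.span {f}) (monomial e (1 : k))) '' (T11Char7Fan.A : Set (Fin 4 →₀ ℕ)))))))) ≃+*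 ↥(blowupAlgebra (Ideal.span ((fun e : Fin 4 →₀ ℕ => Ideal.Quotient.mk (Ideal.span {f}) (monomial e (1 : k))) '' (T11Char7Fan.A : Set (Fin 4 →₀ ℕ)))) (Ideal.Quotient.mk (Ideal.span {f}) (monomial (T11Char7Fan.m c) (1 : k)))))
      (he₀ : ∀ (c : Fin 87) (gg : HomogeneousLocalization.Away (reesGrading (Ideal.span ((fun e : Fin 4 →₀ ℕ => Ideal.Quotient.mk (Ideal.span {f}) (monomial e (1 : k))) '' (T11Char7Fan.A : Set (Fin 4 →₀ ℕ))))) (reesT (I := (Ideal.span ((fun e : Fin 4 →₀ ℕ => Ideal.Quotient.mk (Ideal.span {f}) (monomial e (1 : k))) '' (T11Char7Fan.A : Set (Fin 4 →₀ ℕ))))) (Ideal.Quotient.mk (Ideal.span {f}) (monomial (T11Char7Fan.m c) (1 : k))) (Ideal.subset_span ⟨T11Char7Fan.m c, T11Char7Fan.hmA c, rfl⟩ : (Ideal.Quotient.mk (Ideal.span {f}) (monomial (T11Char7Fan.m c) (1 : k))) ∈ (Ideal.span ((fun e : Fin 4 →₀ ℕ => Ideal.Quotient.mk (Ideal.span {f})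 (monomial e (1 : k))) '' (T11Char7Fan.A : Set (Fin 4 →₀ ℕ))))))),
        e c ((Proj.basicOpenIsoAway (reesGrading (Ideal.span ((fun e : Fin 4 →₀ ℕ => Ideal.Quotient.mk (Ideal.span {f}) (monomial e (1 : k))) '' (T11Char7Fan.A : Set (Fin 4 →₀ ℕ))))) (reesT (I := (Ideal.span ((fun e : Fin 4 →₀ ℕ => Ideal.Quotient.mk (Ideal.span {f}) (monomial e (1 : k))) '' (T11Char7Fan.A : Set (Fin 4 →₀ ℕ))))) (Ideal.Quotient.mk (Ideal.span {f}) (monomial (T11Char7Fan.m c) (1 : k))) (Ideal.subset_span ⟨T11Char7Fan.m c, T11Char7Fan.hmA c, rfl⟩ : (Ideal.Quotient.mk (Ideal.span {f}) (monomial (T11Char7Fan.m c) (1 : k))) ∈ (Ideal.span ((fun e : Fin 4 →₀ ℕ => Ideal.Quotient.mk (Ideal.span {f}) (monomial e (1 : k))) '' (T11Char7Fan.A : Set (Fin 4 →₀ ℕ)))))) (reesT_mem (Ideal.Quotient.mk (Ideal.span {f}) (monomial (T11Char7Fan.m c) (1 : k))) (Ideal.subset_span ⟨T11Char7Fan.m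 c, T11Char7Fan.hmA c, rfl⟩ : (Ideal.Quotient.mk (Ideal.span {f}) (monomial (T11Char7Fan.m c) (1 : k))) ∈ (Ideal.span ((fun e : Fin 4 →₀ ℕ => Ideal.Quotient.mk (Ideal.span {f}) (monomial e (1 : k))) '' (T11Char7Fan.A : Set (Fin 4 →₀ ℕ)))))) Nat.one_pos).hom gg) =
          reesChartEquiv (Ideal.Quotient.mk (Ideal.span {f}) (monomial (T11Char7Fan.m c) (1 : k))) (Ideal.subset_span ⟨T11Char7Fan.m c, T11Char7Fan.hmA c, rfl⟩ : (Ideal.Quotient.mk (Ideal.span {f}) (monomial (T11Char7Fan.m c) (1 : k))) ∈ (Ideal.span ((fun e : Fin 4 →₀ ℕ => Ideal.Quotient.mk (Ideal.span {f}) (monomial e (1 : k))) '' (T11Char7Fan.A : Set (Fin 4 →₀ ℕ))))) gg)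
      (θ : ∀ c : Fin 87, (MvPolynomial (Fin 4) k ⧸ Ideal.span {(KLocCellKit.evalL k (T11Char7Poly.G c))}) ≃+* ↥(blowupAlgebra (Ideal.span ((fun e : Fin 4 →₀ ℕ => Ideal.Quotient.mk (Ideal.span {f}) (monomial e (1 : k))) '' (T11Char7Fan.A : Set (Fin 4 →₀ ℕ)))) (Ideal.Quotient.mk (Ideal.span {f}) (monomial (T11Char7Fan.m c) (1 : k)))))
      (hθ : ∀ (c : Fin 87) (j : Fin 4), ((θ c (Ideal.Quotient.mk (Ideal.span {(KLocCellKit.evalL k (T11Char7Poly.G c))}) (∏ i : Fin 4, (X i : MvPolynomial (Fin 4) k) ^ T11Char7Fan.V c i j))) :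
          Localization.Away (Ideal.Quotient.mk (Ideal.span {f}) (monomial (T11Char7Fan.m c) (1 : k)))) = algebraMap (MvPolynomial (Fin 4) k ⧸ Ideal.span {f}) (Localization.Away (Ideal.Quotient.mk (Ideal.span {f}) (monomial (T11Char7Fan.m c) (1 : k)))) (Ideal.Quotient.mk (Ideal.span {f}) (X j))),
      ∃ ξ : ↥(affineBlowup (Ideal.span ((fun e : Fin 4 →₀ ℕ => Ideal.Quotient.mk (Ideal.span {f}) (monomial e (1 : k))) '' (T11Char7Fan.A : Set (Fin 4 →₀ ℕ))))), (affineBlowup.π (Ideal.span ((fun e : Fin 4 →₀ ℕ => Ideal.Quotient.mk (Ideal.span {f}) (monomial e (1 : k))) '' (T11Char7Fan.A : Set (Fin 4 →₀ ℕ))))).base ξ = (⟨Ideal.span (Set.range fun i : Fin 4 => Ideal.Quotient.mk (Ideal.span {f}) (X i)), (origin_isMaximal f hf0).isPrime⟩ : ↥(Spec (.of (MvPolynomial (Fin 4) k ⧸ Ideal.span {f})))) ∧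
        (∀ c : Fin 87, T11Char3Poly.SSoff c ≠ [] → ((Scheme.IdealSheafData.vanishingIdeal (⟨closure ({ξ} : Set ↥(affineBlowup (Ideal.span ((fun e : Fin 4 →₀ ℕ => Ideal.Quotient.mk (Ideal.span {f}) (monomial e (1 : k))) '' (T11Char7Fan.A : Set (Fin 4 →₀ ℕ)))))), isClosed_closure⟩ : Closeds ↥(affineBlowup (Ideal.span ((fun e : Fin 4 →₀ ℕ => Ideal.Quotient.mk (Ideal.span {f}) (monomial e (1 : k))) '' (T11Char7Fan.A : Set (Fin 4 →₀ ℕ))))))).ideal (⟨(Proj.basicOpen (reesGrading (Ideal.span ((fun e : Fin 4 →₀ ℕ => Ideal.Quotient.mk (Ideal.span {f}) (monomial e (1 : k))) '' (T11Char7Fan.A : Set (Fin 4 →₀ ℕ))))) (reesT (I := (Ideal.span ((fun e : Fin 4 →₀ ℕ => Ideal.Quotient.mk (Ideal.span {f}) (monomial e (1 : k))) '' (T11Char7Fan.A : Set (Fin 4 →₀ ℕ))))) (Ideal.Quotient.mk (Ideal.span {f}) (monomial (T11Char7Fan.m c) (1 : k))) (Ideal.subset_span ⟨T11Char7Fan.m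 c, T11Char7Fan.hmA c, rfl⟩ : (Ideal.Quotient.mk (Ideal.span {f}) (monomial (T11Char7Fan.m c) (1 : k))) ∈ (Ideal.span ((fun e : Fin 4 →₀ ℕ => Ideal.Quotient.mk (Ideal.span {f}) (monomial e (1 : k))) '' (T11Char7Fan.A : Set (Fin 4 →₀ ℕ))))))), AffineBlowupChartFrame.isAffineOpen_basicOpen_reesT (Ideal.span ((fun e : Fin 4 →₀ ℕ => Ideal.Quotient.mk (Ideal.span {f}) (monomial e (1 : k))) '' (T11Char7Fan.A : Set (Fin 4 →₀ ℕ)))) (Ideal.Quotient.mk (Ideal.span {f}) (monomial (T11Char7Fan.m c) (1 : k))) (Ideal.subset_span ⟨T11Char7Fan.m c, T11Char7Fan.hmA c, rfl⟩ : (Ideal.Quotient.mk (Ideal.span {f}) (monomial (T11Char7Fan.m c) (1 : k))) ∈ (Ideal.span ((fun e : Fin 4 →₀ ℕ => Ideal.Quotient.mk (Ideal.span {f}) (monomial e (1 : k))) '' (T11Char7Fan.A : Set (Fin 4 →₀ ℕ)))))⟩ : (affineBlowup (Ideal.span ((fun e : Fin 4 →₀ ℕ => Ideal.Quotient.mk (Ideal.span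 {f}) (monomial e (1 : k))) '' (T11Char7Fan.A : Set (Fin 4 →₀ ℕ))))).affineOpens)).map (e c) ≤ (((Ideal.span {x | x ∈ (T11Char3Poly.HS c).map (KLocCellKit.evalL k)}).map (Ideal.Quotient.mk (Ideal.span {(KLocCellKit.evalL k (T11Char7Poly.G c))})))).map (θ c)) ∧
        ((Scheme.IdealSheafData.vanishingIdeal (⟨closure ({ξ} : Set ↥(affineBlowup (Ideal.span ((fun e : Fin 4 →₀ ℕ => Ideal.Quotient.mk (Ideal.span {f}) (monomial e (1 : k))) '' (T11Char7Fan.A : Set (Fin 4 →₀ ℕ)))))), isClosed_closure⟩ : Closeds ↥(affineBlowup (Ideal.span ((fun e : Fin 4 →₀ ℕ => Ideal.Quotient.mk (Ideal.span {f}) (monomial e (1 : k))) '' (T11Char7Fan.A : Set (Fin 4 →₀ ℕ))))))).ideal (⟨(Proj.basicOpen (reesGrading (Ideal.span ((fun e : Fin 4 →₀ ℕ => Ideal.Quotient.mk (Ideal.span {f}) (monomial e (1 : k))) '' (T11Char7Fan.A : Set (Fin 4 →₀ ℕ))))) (reesT (I := (Ideal.span ((fun e : Fin 4 →₀ ℕ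 => Ideal.Quotient.mk (Ideal.span {f}) (monomial e (1 : k))) '' (T11Char7Fan.A : Set (Fin 4 →₀ ℕ))))) (Ideal.Quotient.mk (Ideal.span {f}) (monomial (T11Char7Fan.m 64) (1 : k))) (Ideal.subset_span ⟨T11Char7Fan.m 64, T11Char7Fan.hmA 64, rfl⟩ : (Ideal.Quotient.mk (Ideal.span {f}) (monomial (T11Char7Fan.m 64) (1 : k))) ∈ (Ideal.span ((fun e : Fin 4 →₀ ℕ => Ideal.Quotient.mk (Ideal.span {f}) (monomial e (1 : k))) '' (T11Char7Fan.A : Set (Fin 4 →₀ ℕ))))))), AffineBlowupChartFrame.isAffineOpen_basicOpen_reesT (Ideal.span ((fun e : Fin 4 →₀ ℕ => Ideal.Quotient.mk (Ideal.span {f}) (monomial e (1 : k))) '' (T11Char7Fan.A : Set (Fin 4 →₀ ℕ)))) (Ideal.Quotient.mk (Ideal.span {f}) (monomial (T11Char7Fan.m 64) (1 : k))) (Ideal.subset_span ⟨T11Char7Fan.m 64, T11Char7Fan.hmA 64, rfl⟩ : (Ideal.Quotient.mk (Ideal.span {f}) (monomial (T11Char7Fan.m 64) (1 : k))) ∈ (Ideal.span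 ((fun e : Fin 4 →₀ ℕ => Ideal.Quotient.mk (Ideal.span {f}) (monomial e (1 : k))) '' (T11Char7Fan.A : Set (Fin 4 →₀ ℕ)))))⟩ : (affineBlowup (Ideal.span ((fun e : Fin 4 →₀ ℕ => Ideal.Quotient.mk (Ideal.span {f}) (monomial e (1 : k))) '' (T11Char7Fan.A : Set (Fin 4 →₀ ℕ))))).affineOpens)).map (e 64) = (((Ideal.span {x | x ∈ (T11Char3Poly.HS 64).map (KLocCellKit.evalL k)}).map (Ideal.Quotient.mk (Ideal.span {(KLocCellKit.evalL k (T11Char7Poly.G 64))})))).map (θ 64) ∧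
        ((Scheme.IdealSheafData.vanishingIdeal (⟨closure ({ξ} : Set ↥(affineBlowup (Ideal.span ((fun e : Fin 4 →₀ ℕ => Ideal.Quotient.mk (Ideal.span {f}) (monomial e (1 : k))) '' (T11Char7Fan.A : Set (Fin 4 →₀ ℕ)))))), isClosed_closure⟩ : Closeds ↥(affineBlowup (Ideal.span ((fun e : Fin 4 →₀ ℕ => Ideal.Quotient.mk (Ideal.span {f}) (monomial e (1 : k))) '' (T11Char7Fan.A : Set (Fin 4 →₀ ℕ))))))).ideal (⟨(Proj.basicOpen (reesGrading (Ideal.span ((fun e : Fin 4 →₀ ℕ => Ideal.Quotient.mk (Ideal.span {f}) (monomial e (1 : k))) '' (T11Char7Fan.A : Set (Fin 4 →₀ ℕ))))) (reesT (I := (Ideal.span ((fun e : Fin 4 →₀ ℕ => Ideal.Quotient.mk (Ideal.span {f}) (monomial e (1 : k))) '' (T11Char7Fan.A : Set (Fin 4 →₀ ℕ))))) (Ideal.Quotient.mk (Ideal.span {f}) (monomial (T11Char7Fan.m 66) (1 : k))) (Ideal.subset_span ⟨T11Char7Fan.m 66, T11Char7Fan.hmA 66, rfl⟩ : (Ideal.Quotient.mk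 (Ideal.span {f}) (monomial (T11Char7Fan.m 66) (1 : k))) ∈ (Ideal.span ((fun e : Fin 4 →₀ ℕ => Ideal.Quotient.mk (Ideal.span {f}) (monomial e (1 : k))) '' (T11Char7Fan.A : Set (Fin 4 →₀ ℕ))))))), AffineBlowupChartFrame.isAffineOpen_basicOpen_reesT (Ideal.span ((fun e : Fin 4 →₀ ℕ => Ideal.Quotient.mk (Ideal.span {f}) (monomial e (1 : k))) '' (T11Char7Fan.A : Set (Fin 4 →₀ ℕ)))) (Ideal.Quotient.mk (Ideal.span {f}) (monomial (T11Char7Fan.m 66) (1 : k))) (Ideal.subset_span ⟨T11Char7Fan.m 66, T11Char7Fan.hmA 66, rfl⟩ : (Ideal.Quotient.mk (Ideal.span {f}) (monomial (T11Char7Fan.m 66) (1 : k))) ∈ (Ideal.span ((fun e : Fin 4 →₀ ℕ => Ideal.Quotient.mk (Ideal.span {f}) (monomial e (1 : k))) '' (T11Char7Fan.A : Set (Fin 4 →₀ ℕ)))))⟩ : (affineBlowup (Ideal.span ((fun e : Fin 4 →₀ ℕ => Ideal.Quotient.mk (Ideal.span {f}) (monomial e (1 : k))) '' (T11Char7Fan.A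 : Set (Fin 4 →₀ ℕ))))).affineOpens)).map (e 66) = (((Ideal.span {x | x ∈ (T11Char3Poly.HS 66).map (KLocCellKit.evalL k)}).map (Ideal.Quotient.mk (Ideal.span {(KLocCellKit.evalL k (T11Char7Poly.G 66))})))).map (θ 66) ∧
        (∀ x' : ↥(affineBlowup (Ideal.span ((fun e : Fin 4 →₀ ℕ => Ideal.Quotient.mk (Ideal.span {f}) (monomial e (1 : k))) '' (T11Char7Fan.A : Set (Fin 4 →₀ ℕ))))), x' ∈ closure ({ξ} : Set ↥(affineBlowup (Ideal.span ((fun e : Fin 4 →₀ ℕ => Ideal.Quotient.mk (Ideal.span {f}) (monomial e (1 : k))) '' (T11Char7Fan.A : Set (Fin 4 →₀ ℕ)))))) → ∃ c ∈ ({64, 66} : Set (Fin 87)), x' ∈ (Proj.basicOpen (reesGrading (Ideal.span ((fun e : Fin 4 →₀ ℕ => Ideal.Quotient.mk (Ideal.span {f}) (monomial e (1 : k))) '' (T11Char7Fan.A : Set (Fin 4 →₀ ℕ))))) (reesT (I := (Ideal.span ((fun e : Fin 4 →₀ ℕ => Ideal.Quotient.mk (Ideal.span {f}) (monomial e (1 :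 k))) '' (T11Char7Fan.A : Set (Fin 4 →₀ ℕ))))) (Ideal.Quotient.mk (Ideal.span {f}) (monomial (T11Char7Fan.m c) (1 : k))) (Ideal.subset_span ⟨T11Char7Fan.m c, T11Char7Fan.hmA c, rfl⟩ : (Ideal.Quotient.mk (Ideal.span {f}) (monomial (T11Char7Fan.m c) (1 : k))) ∈ (Ideal.span ((fun e : Fin 4 →₀ ℕ => Ideal.Quotient.mk (Ideal.span {f}) (monomial e (1 : k))) '' (T11Char7Fan.A : Set (Fin 4 →₀ ℕ)))))))))
    -- LEVEL-2 BLOCKS on the models of the hon charts 64 and 66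
    (hblock64 : ∃ (t₂ : ℕ) (w₂ : Fin t₂ → (MvPolynomial (Fin 4) k ⧸ Ideal.span {(KLocCellKit.evalL k (T11Char7Poly.G 64))})) (hw₂ : ∀ j : Fin t₂, w₂ j ∈ ((Ideal.span {x | x ∈ (T11Char3Poly.HS 64).map (KLocCellKit.evalL k)}).map (Ideal.Quotient.mk (Ideal.span {(KLocCellKit.evalL k (T11Char7Poly.G 64))})))),
        (HomogeneousIdeal.irrelevant (reesGrading ((Ideal.span {x | x ∈ (T11Char3Poly.HS 64).map (KLocCellKit.evalL k)}).map (Ideal.Quotient.mk (Ideal.span {(KLocCellKit.evalL k (T11Char7Poly.G 64))}))))).toIdeal ≤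
          (Ideal.span (Set.range fun j : Fin t₂ => reesT (I := ((Ideal.span {x | x ∈ (T11Char3Poly.HS 64).map (KLocCellKit.evalL k)}).map (Ideal.Quotient.mk (Ideal.span {(KLocCellKit.evalL k (T11Char7Poly.G 64))})))) (w₂ j) (hw₂ j))).radical ∧
        (∀ j : Fin t₂, w₂ j ≠ 0) ∧
        ∀ (j : Fin t₂) (Q : Ideal (blowupAlgebra ((Ideal.span {x | x ∈ (T11Char3Poly.HS 64).map (KLocCellKit.evalL k)}).map (Ideal.Quotient.mk (Ideal.span {(KLocCellKit.evalL k (T11Char7Poly.G 64))}))) (w₂ j))) [Q.IsMaximal],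
          algebraMap (MvPolynomial (Fin 4) k ⧸ Ideal.span {(KLocCellKit.evalL k (T11Char7Poly.G 64))}) (blowupAlgebra ((Ideal.span {x | x ∈ (T11Char3Poly.HS 64).map (KLocCellKit.evalL k)}).map (Ideal.Quotient.mk (Ideal.span {(KLocCellKit.evalL k (T11Char7Poly.G 64))}))) (w₂ j)) (w₂ j) ∈ Q →
          ∀ dd : ℕ, ringKrullDim (Localization.AtPrime Q) = dd → ∀ s : Fin dd → Localization.AtPrime Q,
          (Ideal.span (Set.range s)).radical.IsMaximal →
            RingTheory.Sequence.IsWeaklyRegular (Localization.AtPrime Q) (List.ofFn s) ∧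
            ∀ y : Localization.AtPrime Q, (∃ e : ℕ, y ^ 3 ^ e ∈ Ideal.span
              ((fun z : Localization.AtPrime Q => z ^ 3 ^ e) ''
                (Ideal.span (Set.range s) : Set (Localization.AtPrime Q)))) → y ∈ Ideal.span (Set.range s))
    (hblock66 : ∃ (t₂ : ℕ) (w₂ : Fin t₂ → (MvPolynomial (Fin 4) k ⧸ Ideal.span {(KLocCellKit.evalL k (T11Char7Poly.G 66))})) (hw₂ : ∀ j : Fin t₂, w₂ j ∈ ((Ideal.span {x | x ∈ (T11Char3Poly.HS 66).map (KLocCellKit.evalL k)}).map (Ideal.Quotient.mk (Ideal.span {(KLocCellKit.evalL k (T11Char7Poly.G 66))})))),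
        (HomogeneousIdeal.irrelevant (reesGrading ((Ideal.span {x | x ∈ (T11Char3Poly.HS 66).map (KLocCellKit.evalL k)}).map (Ideal.Quotient.mk (Ideal.span {(KLocCellKit.evalL k (T11Char7Poly.G 66))}))))).toIdeal ≤
          (Ideal.span (Set.range fun j : Fin t₂ => reesT (I := ((Ideal.span {x | x ∈ (T11Char3Poly.HS 66).map (KLocCellKit.evalL k)}).map (Ideal.Quotient.mk (Ideal.span {(KLocCellKit.evalL k (T11Char7Poly.G 66))})))) (w₂ j) (hw₂ j))).radical ∧
        (∀ j : Fin t₂, w₂ j ≠ 0) ∧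
        ∀ (j : Fin t₂) (Q : Ideal (blowupAlgebra ((Ideal.span {x | x ∈ (T11Char3Poly.HS 66).map (KLocCellKit.evalL k)}).map (Ideal.Quotient.mk (Ideal.span {(KLocCellKit.evalL k (T11Char7Poly.G 66))}))) (w₂ j))) [Q.IsMaximal],
          algebraMap (MvPolynomial (Fin 4) k ⧸ Ideal.span {(KLocCellKit.evalL k (T11Char7Poly.G 66))}) (blowupAlgebra ((Ideal.span {x | x ∈ (T11Char3Poly.HS 66).map (KLocCellKit.evalL k)}).map (Ideal.Quotient.mk (Ideal.span {(KLocCellKit.evalL k (T11Char7Poly.G 66))}))) (w₂ j)) (w₂ j) ∈ Q →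
          ∀ dd : ℕ, ringKrullDim (Localization.AtPrime Q) = dd → ∀ s : Fin dd → Localization.AtPrime Q,
          (Ideal.span (Set.range s)).radical.IsMaximal →
            RingTheory.Sequence.IsWeaklyRegular (Localization.AtPrime Q) (List.ofFn s) ∧
            ∀ y : Localization.AtPrime Q, (∃ e : ℕ, y ^ 3 ^ e ∈ Ideal.span
              ((fun z : Localization.AtPrime Q => z ^ 3 ^ e) ''
                (Ideal.span (Set.range s) : Set (Localization.AtPrime Q)))) → y ∈ Ideal.span (Set.range s)) :
    ∃ (nc : ℕ) (c : Fin nc → (Spec (.of (MvPolynomial (Fin 4) k ⧸ Ideal.span {f}))).presheaf.stalk (⟨Ideal.span (Set.range fun i : Fin 4 => Ideal.Quotient.mk (Ideal.span {f}) (X i)), (origin_isMaximal f hf0).isPrime⟩ : ↥(Spec (.of (MvPolynomial (Fin 4) k ⧸ Ideal.span {f}))))), Ideal.span (Set.range c) ≠ ⊥ ∧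
      (Ideal.span (Set.range c)).radical = IsLocalRing.maximalIdeal ((Spec (.of (MvPolynomial (Fin 4) k ⧸ Ideal.span {f}))).presheaf.stalk (⟨Ideal.span (Set.range fun i : Fin 4 => Ideal.Quotient.mk (Ideal.span {f}) (X i)), (origin_isMaximal f hf0).isPrime⟩ : ↥(Spec (.of (MvPolynomial (Fin 4) k ⧸ Ideal.span {f}))))) ∧
      ∀ (j : Fin nc) (𝔔 : PrimeSpectrum (blowupAlgebra (Ideal.span (Set.range c)) (c j))),
        𝔔.asIdeal.comap (algebraMap ((Spec (.of (MvPolynomial (Fin 4) k ⧸ Ideal.span {f}))).presheaf.stalk (⟨Ideal.span (Set.range fun i : Fin 4 => Ideal.Quotient.mk (Ideal.span {f}) (X i)), (origin_isMaximal f hf0).isPrime⟩ : ↥(Spec (.of (MvPolynomial (Fin 4) k ⧸ Ideal.span {f}))))) (blowupAlgebra (Ideal.span (Set.range c)) (c j))) =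
          IsLocalRing.maximalIdeal ((Spec (.of (MvPolynomial (Fin 4) k ⧸ Ideal.span {f}))).presheaf.stalk (⟨Ideal.span (Set.range fun i : Fin 4 => Ideal.Quotient.mk (Ideal.span {f}) (X i)), (origin_isMaximal f hf0).isPrime⟩ : ↥(Spec (.of (MvPolynomial (Fin 4) k ⧸ Ideal.span {f}))))) →
        IsDomain (Localization.AtPrime 𝔔.asIdeal) ∧ ∀ dd : ℕ, ringKrullDim (Localization.AtPrime 𝔔.asIdeal) = dd → ∀ s : Fin dd → Localization.AtPrime 𝔔.asIdeal,
          (Ideal.span (Set.range s)).radical.IsMaximal →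
            RingTheory.Sequence.IsWeaklyRegular (Localization.AtPrime 𝔔.asIdeal) (List.ofFn s) ∧
            ∀ y : Localization.AtPrime 𝔔.asIdeal, (∃ e : ℕ, y ^ 3 ^ e ∈ Ideal.span
              ((fun z : Localization.AtPrime 𝔔.asIdeal => z ^ 3 ^ e) ''
                (Ideal.span (Set.range s) : Set (Localization.AtPrime 𝔔.asIdeal)))) → y ∈ Ideal.span (Set.range s) := by
  classical
  haveI : Fact (Nat.Prime 3) := ⟨Nat.prime_three⟩
  have hprime : (Ideal.span {f}).IsPrime := T11HypersurfacePrime.isPrime_span_T11 k f hf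
  have hXne : ∀ v : Fin 4, Ideal.Quotient.mk (Ideal.span {f}) (X v) ≠ 0 := T11HypersurfacePrime.mk_X_ne_zero_T11 k f hf
  haveI := hprime
  haveI : IsDomain (MvPolynomial (Fin 4) k ⧸ Ideal.span {f}) := Ideal.Quotient.isDomain _
  haveI : CharP (MvPolynomial (Fin 4) k ⧸ Ideal.span {f}) 3 := charP_of_injective_algebraMap (algebraMap k (MvPolynomial (Fin 4) k ⧸ Ideal.span {f})).injective 3
  -- the origin, the centre
  have hbmax := origin_isMaximal f hf0
  have hIb := radical_monomialCentre_eq_origin f hf0 T11Char7Fan.A T11Char7Fan.hprim T11Char7Fan.hAJ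
  have hI0 := monomialCentre_ne_bot f (by norm_num) hXne T11Char7Fan.A T11Char7Fan.hAJ
  have hw0 : ∀ c : Fin 87, Ideal.Quotient.mk (Ideal.span {f}) (monomial (T11Char7Fan.m c) (1 : k)) ≠ 0 := fun c =>
    CIConeFiModelCore.mk_monomial_ne_zero (Ideal.span {f}) hXne (T11Char7Fan.m c)
  have hcover := reesCover_of_fanCover f T11Char7Fan.A T11Char7Fan.m T11Char7Fan.hmA (T11Char7Fan.hcov k)
  -- the pinned sections isomorphisms of the 87 Rees charts
  have hex := fun c : Fin 87 => AffineBlowupChartTransport.exists_sectionsEquiv_eq (Ideal.span ((fun e : Fin 4 →₀ ℕ => Ideal.Quotient.mk (Ideal.span {f}) (monomial e (1 : k))) '' (T11Char7Fan.A : Set (Fin 4 →₀ ℕ))))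
    (Ideal.Quotient.mk (Ideal.span {f}) (monomial (T11Char7Fan.m c) (1 : k)))
    (Ideal.subset_span ⟨T11Char7Fan.m c, T11Char7Fan.hmA c, rfl⟩ : Ideal.Quotient.mk (Ideal.span {f}) (monomial (T11Char7Fan.m c) (1 : k)) ∈ (Ideal.span ((fun e : Fin 4 →₀ ℕ => Ideal.Quotient.mk (Ideal.span {f}) (monomial e (1 : k))) '' (T11Char7Fan.A : Set (Fin 4 →₀ ℕ)))))
  choose e he₀ using hex
  have he : ∀ (c : Fin 87) (r : (MvPolynomial (Fin 4) k ⧸ Ideal.span {f})), e c ((affineBlowup.π (Ideal.span ((fun e : Fin 4 →₀ ℕ => Ideal.Quotient.mk (Ideal.span {f}) (monomial e (1 : k))) '' (T11Char7Fan.A : Set (Fin 4 →₀ ℕ))))).appLE ⊤ _ le_top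
      ((Scheme.ΓSpecIso (CommRingCat.of (MvPolynomial (Fin 4) k ⧸ Ideal.span {f}))).inv r)) = algebraMap (MvPolynomial (Fin 4) k ⧸ Ideal.span {f}) _ r := fun c r =>
    AffineBlowupChartTransport.compat_of_sectionsEquiv_eq (e c) (he₀ c) r
  -- the (C1) chart presentations
  have hexθ := fun c : Fin 87 => MonomialChartPresentationPrime.exists_monomialChartPresentation_of_isPrime f (T11Char7Fan.V c)
    (T11Char7Fan.hV c) (T11Char7Fan.m c) (T11Char7Fan.a c) (T11Char7Fan.hgen c) T11Char7Fan.A (T11Char7Fan.haA c) (T11Char7Fan.hge c)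
    (T11Char7Fan.d c 0) (KLocCellKit.evalL k (T11Char7Poly.G c)) (by subst hf; exact T11Char7Poly.hθF₀ k c) hprime hXne
    (T11Char3Poly.hX3 k c)
  choose θ₀ hbij hθ₀ using hexθ
  have hθ : ∀ (c : Fin 87) (j : Fin 4), ((RingEquiv.ofBijective (θ₀ c) (hbij c)
      (Ideal.Quotient.mk (Ideal.span {KLocCellKit.evalL k (T11Char7Poly.G c)}) (∏ i : Fin 4, (X i : MvPolynomial (Fin 4) k) ^ T11Char7Fan.V c i j))) :
        Localization.Away (Ideal.Quotient.mk (Ideal.span {f}) (monomial (T11Char7Fan.m c) (1 : k)))) =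
      algebraMap (MvPolynomial (Fin 4) k ⧸ Ideal.span {f}) (Localization.Away (Ideal.Quotient.mk (Ideal.span {f}) (monomial (T11Char7Fan.m c) (1 : k)))) (Ideal.Quotient.mk (Ideal.span {f}) (X j)) := by
    intro c j
    have h := hθ₀ c (X j)
    rw [aeval_X] at h
    exact h
  have H := hR3 e he₀ (fun c => RingEquiv.ofBijective (θ₀ c) (hbij c)) hθ
  obtain ⟨ξ, hrest⟩ := H
  have hξ := hrest.1
  have hR3a := hrest.2.1
  have hR3b64 := hrest.2.2.1
  have hR3b66 := hrest.2.2.2.1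
  have hSc := hrest.2.2.2.2
  -- (R3a): the true curve ideal lies in the model ideal (`⊤` off the avoid charts)
  have hP'' : ∀ c : Fin 87, ((Scheme.IdealSheafData.vanishingIdeal (⟨closure ({ξ} : Set ↥(affineBlowup (Ideal.span ((fun e : Fin 4 →₀ ℕ => Ideal.Quotient.mk (Ideal.span {f}) (monomial e (1 : k))) '' (T11Char7Fan.A : Set (Fin 4 →₀ ℕ)))))), isClosed_closure⟩ : Closeds ↥(affineBlowup (Ideal.span ((fun e : Fin 4 →₀ ℕ => Ideal.Quotient.mk (Ideal.span {f}) (monomial e (1 : k))) '' (T11Char7Fan.A : Set (Fin 4 →₀ ℕ))))))).ideal (⟨(Proj.basicOpen (reesGrading (Ideal.span ((fun e : Fin 4 →₀ ℕ => Ideal.Quotient.mk (Ideal.span {f}) (monomial e (1 : k))) '' (T11Char7Fan.A : Set (Fin 4 →₀ ℕ))))) (reesT (I := (Ideal.span ((fun e : Fin 4 →₀ ℕ => Ideal.Quotient.mk (Ideal.span {f}) (monomial e (1 : k))) '' (T11Char7Fan.A : Set (Fin 4 →₀ ℕ))))) (Ideal.Quotient.mk (Ideal.span {f}) (monomial (T11Char7Fan.m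 c) (1 : k))) (Ideal.subset_span ⟨T11Char7Fan.m c, T11Char7Fan.hmA c, rfl⟩ : (Ideal.Quotient.mk (Ideal.span {f}) (monomial (T11Char7Fan.m c) (1 : k))) ∈ (Ideal.span ((fun e : Fin 4 →₀ ℕ => Ideal.Quotient.mk (Ideal.span {f}) (monomial e (1 : k))) '' (T11Char7Fan.A : Set (Fin 4 →₀ ℕ))))))), AffineBlowupChartFrame.isAffineOpen_basicOpen_reesT (Ideal.span ((fun e : Fin 4 →₀ ℕ => Ideal.Quotient.mk (Ideal.span {f}) (monomial e (1 : k))) '' (T11Char7Fan.A : Set (Fin 4 →₀ ℕ)))) (Ideal.Quotient.mk (Ideal.span {f}) (monomial (T11Char7Fan.m c) (1 : k))) (Ideal.subset_span ⟨T11Char7Fan.m c, T11Char7Fan.hmA c, rfl⟩ : (Ideal.Quotient.mk (Ideal.span {f}) (monomial (T11Char7Fan.m c) (1 : k))) ∈ (Ideal.span ((fun e : Fin 4 →₀ ℕ => Ideal.Quotient.mk (Ideal.span {f}) (monomial e (1 : k))) '' (T11Char7Fan.A : Set (Fin 4 →₀ ℕ)))))⟩ : (affineBlowup (Ideal.span ((fun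 e : Fin 4 →₀ ℕ => Ideal.Quotient.mk (Ideal.span {f}) (monomial e (1 : k))) '' (T11Char7Fan.A : Set (Fin 4 →₀ ℕ))))).affineOpens)).map (e c) ≤
      ((if T11Char3Poly.SSoff c = [] then ⊤ else ((Ideal.span {x | x ∈ (T11Char3Poly.HS c).map (KLocCellKit.evalL k)}).map (Ideal.Quotient.mk (Ideal.span {(KLocCellKit.evalL k (T11Char7Poly.G c))}))))).map (RingEquiv.ofBijective (θ₀ c) (hbij c)) := by
    intro c
    by_cases h : T11Char3Poly.SSoff c = []
    · simp only [h, ↓reduceIte, Ideal.map_top]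
      exact le_top
    · simp only [h, ↓reduceIte]
      exact hR3a c h
  -- the model fibre ideals `(θ_c(x_j))_j` are `𝔪₀ · R[I/w_c]`
  have h𝔟'' : ∀ c : Fin 87, ((Ideal.span (Set.range fun j : Fin 4 => Ideal.Quotient.mk (Ideal.span {(KLocCellKit.evalL k (T11Char7Poly.G c))}) (aeval (fun j : Fin 4 => ∏ i : Fin 4, (X i : MvPolynomial (Fin 4) k) ^ T11Char7Fan.V c i j) (X j : MvPolynomial (Fin 4) k))))).map (RingEquiv.ofBijective (θ₀ c) (hbij c)) =
      (Ideal.span (Set.range fun i : Fin 4 => Ideal.Quotient.mk (Ideal.span {f}) (X i))).map (algebraMap (MvPolynomial (Fin 4) k ⧸ Ideal.span {f}) (blowupAlgebra (Ideal.span ((fun e : Fin 4 →₀ ℕ => Ideal.Quotient.mk (Ideal.span {f}) (monomial e (1 : k))) '' (T11Char7Fan.A : Set (Fin 4 →₀ ℕ)))) (Ideal.Quotient.mk (Ideal.span {f}) (monomial (T11Char7Fan.m c) (1 : k))))) := by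
    intro c
    rw [Ideal.map_span, Ideal.map_span, ← Set.range_comp, ← Set.range_comp]
    refine congrArg Ideal.span (congrArg Set.range (funext fun j => ?_))
    apply Subtype.ext
    simp only [Function.comp_apply, aeval_X]
    rw [hθ c j]
    rfl
  -- LEVEL-1 model clauses from the producers
  have hmodel : ∀ (c : Fin 87) (Q' : Ideal (MvPolynomial (Fin 4) k ⧸ Ideal.span {(KLocCellKit.evalL k (T11Char7Poly.G c))})) [Q'.IsMaximal], ¬ (if T11Char3Poly.SSoff c = [] then ⊤ else ((Ideal.span {x | x ∈ (T11Char3Poly.HS c).map (KLocCellKit.evalL k)}).map (Ideal.Quotient.mk (Ideal.span {(KLocCellKit.evalL k (T11Char7Poly.G c))})))) ≤ Q' → (Ideal.span (Set.range fun j : Fin 4 => Ideal.Quotient.mk (Ideal.span {(KLocCellKit.evalL k (T11Char7Poly.G c))}) (aeval (fun j : Fin 4 => ∏ i : Fin 4, (X i : MvPolynomial (Fin 4) k) ^ T11Char7Fan.V c i j) (X j : MvPolynomial (Fin 4) k)))) ≤ Q' →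
      ∀ dd : ℕ, ringKrullDim (Localization.AtPrime Q') = dd → ∀ s : Fin dd → Localization.AtPrime Q',
          (Ideal.span (Set.range s)).radical.IsMaximal →
            RingTheory.Sequence.IsWeaklyRegular (Localization.AtPrime Q') (List.ofFn s) ∧
            ∀ y : Localization.AtPrime Q', (∃ e : ℕ, y ^ 3 ^ e ∈ Ideal.span
              ((fun z : Localization.AtPrime Q' => z ^ 3 ^ e) ''
                (Ideal.span (Set.range s) : Set (Localization.AtPrime Q')))) → y ∈ Ideal.span (Set.range s) := by
    intro c Q' _ hPQ hbQ
    have hj : ∀ j ∈ (Finset.univ : Finset (Fin 4)), Ideal.Quotient.mk (Ideal.span {(KLocCellKit.evalL k (T11Char7Poly.G c))})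
        (aeval (fun j : Fin 4 => ∏ i : Fin 4, (X i : MvPolynomial (Fin 4) k) ^ T11Char7Fan.V c i j) (X j : MvPolynomial (Fin 4) k)) ∈ Q' :=
      fun j _ => hbQ (Ideal.subset_span ⟨j, rfl⟩)
    by_cases h : T11Char3Poly.SSoff c = []
    · exact hstd c h Q' hj
    · have hPQ' : ¬ ((Ideal.span {x | x ∈ (T11Char3Poly.HS c).map (KLocCellKit.evalL k)}).map (Ideal.Quotient.mk (Ideal.span {(KLocCellKit.evalL k (T11Char7Poly.G c))}))) ≤ Q' := by
        simpa only [h, ↓reduceIte] using hPQ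
      exact hoff c h Q' hj hPQ'
  -- (R3b) and the LEVEL-2 blocks on the two hon charts
  have hI₂ : ∀ σ : ↥(({64, 66} : Set (Fin 87))), ((Scheme.IdealSheafData.vanishingIdeal (⟨closure ({ξ} : Set ↥(affineBlowup (Ideal.span ((fun e : Fin 4 →₀ ℕ => Ideal.Quotient.mk (Ideal.span {f}) (monomial e (1 : k))) '' (T11Char7Fan.A : Set (Fin 4 →₀ ℕ)))))), isClosed_closure⟩ : Closeds ↥(affineBlowup (Ideal.span ((fun e : Fin 4 →₀ ℕ => Ideal.Quotient.mk (Ideal.span {f}) (monomial e (1 : k))) '' (T11Char7Fan.A : Set (Fin 4 →₀ ℕ))))))).ideal (⟨(Proj.basicOpen (reesGrading (Ideal.span ((fun e : Fin 4 →₀ ℕ => Ideal.Quotient.mk (Ideal.span {f}) (monomial e (1 : k))) '' (T11Char7Fan.A : Set (Fin 4 →₀ ℕ))))) (reesT (I := (Ideal.span ((fun e : Fin 4 →₀ ℕ => Ideal.Quotient.mk (Ideal.span {f}) (monomial e (1 : k))) '' (T11Char7Fan.A : Set (Fin 4 →₀ ℕ))))) (Ideal.Quotient.mk (Ideal.span {f})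 (monomial (T11Char7Fan.m σ) (1 : k))) (Ideal.subset_span ⟨T11Char7Fan.m σ, T11Char7Fan.hmA σ, rfl⟩ : (Ideal.Quotient.mk (Ideal.span {f}) (monomial (T11Char7Fan.m σ) (1 : k))) ∈ (Ideal.span ((fun e : Fin 4 →₀ ℕ => Ideal.Quotient.mk (Ideal.span {f}) (monomial e (1 : k))) '' (T11Char7Fan.A : Set (Fin 4 →₀ ℕ))))))), AffineBlowupChartFrame.isAffineOpen_basicOpen_reesT (Ideal.span ((fun e : Fin 4 →₀ ℕ => Ideal.Quotient.mk (Ideal.span {f}) (monomial e (1 : k))) '' (T11Char7Fan.A : Set (Fin 4 →₀ ℕ)))) (Ideal.Quotient.mk (Ideal.span {f}) (monomial (T11Char7Fan.m σ) (1 : k))) (Ideal.subset_span ⟨T11Char7Fan.m σ, T11Char7Fan.hmA σ, rfl⟩ : (Ideal.Quotient.mk (Ideal.span {f}) (monomial (T11Char7Fan.m σ) (1 : k))) ∈ (Ideal.span ((fun e : Fin 4 →₀ ℕ => Ideal.Quotient.mk (Ideal.span {f}) (monomial e (1 : k))) '' (T11Char7Fan.A : Set (Fin 4 →₀ ℕ)))))⟩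 : (affineBlowup (Ideal.span ((fun e : Fin 4 →₀ ℕ => Ideal.Quotient.mk (Ideal.span {f}) (monomial e (1 : k))) '' (T11Char7Fan.A : Set (Fin 4 →₀ ℕ))))).affineOpens)).map (e σ) =
      (((Ideal.span {x | x ∈ (T11Char3Poly.HS σ).map (KLocCellKit.evalL k)}).map (Ideal.Quotient.mk (Ideal.span {(KLocCellKit.evalL k (T11Char7Poly.G σ))})))).map (RingEquiv.ofBijective (θ₀ σ) (hbij σ)) := by
    rintro ⟨c, hc⟩
    rcases (Set.mem_insert_iff.mp hc) with rfl | hc'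
    · exact hR3b64
    · rw [Set.mem_singleton_iff] at hc'
      subst hc'
      exact hR3b66
  have hblock : ∀ σ : ↥(({64, 66} : Set (Fin 87))),
      ∃ (t₂ : ℕ) (w₂ : Fin t₂ → (MvPolynomial (Fin 4) k ⧸ Ideal.span {(KLocCellKit.evalL k (T11Char7Poly.G σ))})) (hw₂ : ∀ j : Fin t₂, w₂ j ∈ ((Ideal.span {x | x ∈ (T11Char3Poly.HS σ).map (KLocCellKit.evalL k)}).map (Ideal.Quotient.mk (Ideal.span {(KLocCellKit.evalL k (T11Char7Poly.G σ))})))),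
        (HomogeneousIdeal.irrelevant (reesGrading ((Ideal.span {x | x ∈ (T11Char3Poly.HS σ).map (KLocCellKit.evalL k)}).map (Ideal.Quotient.mk (Ideal.span {(KLocCellKit.evalL k (T11Char7Poly.G σ))}))))).toIdeal ≤
          (Ideal.span (Set.range fun j : Fin t₂ => reesT (I := ((Ideal.span {x | x ∈ (T11Char3Poly.HS σ).map (KLocCellKit.evalL k)}).map (Ideal.Quotient.mk (Ideal.span {(KLocCellKit.evalL k (T11Char7Poly.G σ))})))) (w₂ j) (hw₂ j))).radical ∧
        (∀ j : Fin t₂, w₂ j ≠ 0) ∧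
        ∀ (j : Fin t₂) (Q : Ideal (blowupAlgebra ((Ideal.span {x | x ∈ (T11Char3Poly.HS σ).map (KLocCellKit.evalL k)}).map (Ideal.Quotient.mk (Ideal.span {(KLocCellKit.evalL k (T11Char7Poly.G σ))}))) (w₂ j))) [Q.IsMaximal],
          algebraMap (MvPolynomial (Fin 4) k ⧸ Ideal.span {(KLocCellKit.evalL k (T11Char7Poly.G σ))}) (blowupAlgebra ((Ideal.span {x | x ∈ (T11Char3Poly.HS σ).map (KLocCellKit.evalL k)}).map (Ideal.Quotient.mk (Ideal.span {(KLocCellKit.evalL k (T11Char7Poly.G σ))}))) (w₂ j)) (w₂ j) ∈ Q →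
          ∀ dd : ℕ, ringKrullDim (Localization.AtPrime Q) = dd → ∀ s : Fin dd → Localization.AtPrime Q,
          (Ideal.span (Set.range s)).radical.IsMaximal →
            RingTheory.Sequence.IsWeaklyRegular (Localization.AtPrime Q) (List.ofFn s) ∧
            ∀ y : Localization.AtPrime Q, (∃ e : ℕ, y ^ 3 ^ e ∈ Ideal.span
              ((fun z : Localization.AtPrime Q => z ^ 3 ^ e) ''
                (Ideal.span (Set.range s) : Set (Localization.AtPrime Q)))) → y ∈ Ideal.span (Set.range s) := by
    rintro ⟨c, hc⟩
    rcases (Set.mem_insert_iff.mp hc) with rfl | hc'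
    · exact hblock64
    · rw [Set.mem_singleton_iff] at hc'
      subst hc'
      exact hblock66
  -- the road frame, both levels on the models
  exact TwoLevelRoadFrame.pointFixable_of_chartModels₂ 3 (MvPolynomial (Fin 4) k ⧸ Ideal.span {f}) (Ideal.span ((fun e : Fin 4 →₀ ℕ => Ideal.Quotient.mk (Ideal.span {f}) (monomial e (1 : k))) '' (T11Char7Fan.A : Set (Fin 4 →₀ ℕ)))) hI0 _ hbmax hIb 87
    (fun c => (Ideal.Quotient.mk (Ideal.span {f}) (monomial (T11Char7Fan.m c) (1 : k)))) (fun c => (Ideal.subset_span ⟨T11Char7Fan.m c, T11Char7Fan.hmA c, rfl⟩ : (Ideal.Quotient.mk (Ideal.span {f}) (monomial (T11Char7Fan.m c) (1 : k))) ∈ (Ideal.span ((fun e : Fin 4 →₀ ℕ => Ideal.Quotient.mk (Ideal.span {f}) (monomial e (1 : k))) '' (T11Char7Fan.A : Set (Fin 4 →₀ ℕ)))))) hw0 hcover e he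
    (fun c => (MvPolynomial (Fin 4) k ⧸ Ideal.span {(KLocCellKit.evalL k (T11Char7Poly.G c))})) (fun c => RingEquiv.ofBijective (θ₀ c) (hbij c)) ξ hξ
    (fun c => (if T11Char3Poly.SSoff c = [] then ⊤ else ((Ideal.span {x | x ∈ (T11Char3Poly.HS c).map (KLocCellKit.evalL k)}).map (Ideal.Quotient.mk (Ideal.span {(KLocCellKit.evalL k (T11Char7Poly.G c))}))))) hP'' (fun c => (Ideal.span (Set.range fun j : Fin 4 => Ideal.Quotient.mk (Ideal.span {(KLocCellKit.evalL k (T11Char7Poly.G c))}) (aeval (fun j : Fin 4 => ∏ i : Fin 4, (X i : MvPolynomial (Fin 4) k) ^ T11Char7Fan.V c i j) (X j : MvPolynomial (Fin 4) k))))) h𝔟'' hmodel ({64, 66} : Set (Fin 87)) hSc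
    (fun σ => ((Ideal.span {x | x ∈ (T11Char3Poly.HS σ).map (KLocCellKit.evalL k)}).map (Ideal.Quotient.mk (Ideal.span {(KLocCellKit.evalL k (T11Char7Poly.G σ))})))) hI₂ hblock


end Summit.ResolutionOfSingularities.ResolutionOfSingularities.Theorems.FInjectiveMacaulayfication.T11Char3Frame

end
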